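import Summits.KontsevichZagierPeriods.KontsevichZagierPeriods.Theses.RootDecompZetaThreeFrontier
import HarnessLib
import Summits.KontsevichZagierPeriods.KontsevichZagierPeriods.Theorems.RootDecompZetaThreeFrontierGZLadderThreeWlog
import Summits.KontsevichZagierPeriods.KontsevichZagierPeriods.Theorems.RootDecompZetaThreeFrontierGZLadderThreeOrders

/-! # decomp-kz lens-1 gen 11 — `MatchPrelude.lean`: §24 GAP FORM + §25–§26 CONVERGENCE ENGINES + §27 ANALYTIC HALF OF MATCH
(one module = `GapForm.lean` ++ `LayerConv.lean` (v2) ++ §27 on top of the LANDED `…Theorems.RootDecompZetaThreeFrontierGZLadderThreeWlog`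
(which supplies the skeleton-local `simplex`); the recommended landing unit for the MATCH residual
`stub_three_match : ∀ r, IsReducedOrdThree r → CongInto (layerThree ∪ gzLETwo) (KZ.of r)` of the registered skeleton «gz_ladder» on
stmt-KontsevichZagierPeriods-32433).  farm `lean check`: rc 0, 0 errors, 0 warnings, 0 sorries; standard axioms (audits pinned). -/

/-! # `RootDecompZetaThreeFrontierWordMatchPreludeP1` — part 1/5 of the mechanical ≤360-line split of `MatchPrelude.stripped.lean`
(split by the decomp-kz census seat for landing; mathematics unchanged). -/

/-!
# decomp-kz lens-1 g11 — §24 THE GAP FORM (second addendum; a separate file because the node file `WordLayer.lean`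
# (v2, 518 765 B) + §24 exceeds the farm's request cap of 512 KiB — landers splice §24 after §23 and drop §24·0)

Contents: §24·0 verbatim copies of the WordLayer §3/§22 prerequisites (`duΦ`, `s01`, `s01P`, `duP3`, `aeval_s01P`, `aeval_duP3`,
`exists_aeval_ne_zero`) so that this file elaborates on its own; §24a–e the gap form (`gap_form`); §24f the by-name tool
`GZLadder.gapForm_of_isReducedOrdThree` over the verbatim skeleton-local defs (`simplex`, `dual3`, `diag3`, `IsReducedOrdThree` of
§23e / proposal `gz_ladder32433_v2_split.lean`).
-/

noncomputable section

namespace Summit.KontsevichZagierPeriods.RootDecompZetaThreeFrontier.WordLayer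

open Set MeasureTheory
open Literature.NumberTheory.Transcendental

/-! ### 24·0  verbatim copies of WordLayer §3/§22 prerequisites (DROP when splicing after §23) -/

section GapFormPrereqs

/-- Auxiliary step `duΦ`. [bookkeeping] -/
def duΦ (z : Fin 3 → ℝ) : Fin 3 → ℝ := ![1 - z 2, 1 - z 1, 1 - z 0]
/-- Auxiliary step `duΦ_zero`. [bookkeeping] -/
theorem duΦ_zero (z : Fin 3 → ℝ) : duΦ z 0 = 1 - z 2 := by simp [duΦ]
/-- Auxiliary step `duΦ_one`. [bookkeeping] -/
theorem duΦ_one (z : Fin 3 → ℝ) : duΦ z 1 = 1 - z 1 := by simp [duΦ]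
/-- Auxiliary step `duΦ_two`. [bookkeeping] -/
theorem duΦ_two (z : Fin 3 → ℝ) : duΦ z 2 = 1 - z 0 := by simp [duΦ]
/-- Auxiliary step `duΦ_duΦ`. [bookkeeping] -/
theorem duΦ_duΦ (z : Fin 3 → ℝ) : duΦ (duΦ z) = z := by
  funext i
  fin_cases i <;> simp [duΦ_zero, duΦ_one, duΦ_two]

/-- Auxiliary step `s01`. [bookkeeping] -/
def s01 (z : Fin 3 → ℝ) : Fin 3 → ℝ := ![z 0, z 0 - z 2, z 0 - z 1]
/-- Auxiliary step `s01_zero`. [bookkeeping] -/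
theorem s01_zero (z : Fin 3 → ℝ) : s01 z 0 = z 0 := by simp [s01]
/-- Auxiliary step `s01_one`. [bookkeeping] -/
theorem s01_one (z : Fin 3 → ℝ) : s01 z 1 = z 0 - z 2 := by simp [s01]
/-- Auxiliary step `s01_two`. [bookkeeping] -/
theorem s01_two (z : Fin 3 → ℝ) : s01 z 2 = z 0 - z 1 := by simp [s01]
/-- Auxiliary step `s01_s01`. [bookkeeping] -/
theorem s01_s01 (z : Fin 3 → ℝ) : s01 (s01 z) = z := by
  funext i
  fin_cases i <;> simp [s01_zero, s01_one, s01_two]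

/-- Auxiliary step `s01P`. [bookkeeping] -/
def s01P : MvPolynomial (Fin 3) ℚ →ₐ[ℚ] MvPolynomial (Fin 3) ℚ :=
  MvPolynomial.bind₁ ![MvPolynomial.X 0, MvPolynomial.X 0 - MvPolynomial.X 2, MvPolynomial.X 0 - MvPolynomial.X 1]

/-- Auxiliary step `aeval_s01P`. [bookkeeping] -/
theorem aeval_s01P (p : MvPolynomial (Fin 3) ℚ) (t : Fin 3 → ℝ) :
    MvPolynomial.aeval t (s01P p) = MvPolynomial.aeval (s01 t) p := by
  have e : (fun i => MvPolynomial.aeval t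
      ((![MvPolynomial.X 0, MvPolynomial.X 0 - MvPolynomial.X 2, MvPolynomial.X 0 - MvPolynomial.X 1] :
        Fin 3 → MvPolynomial (Fin 3) ℚ) i)) = s01 t := by
    funext i
    fin_cases i <;> simp [s01_zero, s01_one, s01_two]
  rw [s01P, MvPolynomial.aeval_bind₁, e]

/-- Auxiliary step `duP3`. [bookkeeping] -/
def duP3 : MvPolynomial (Fin 3) ℚ →ₐ[ℚ] MvPolynomial (Fin 3) ℚ :=
  MvPolynomial.bind₁ ![MvPolynomial.C 1 - MvPolynomial.X 2, MvPolynomial.C 1 - MvPolynomial.X 1,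
    MvPolynomial.C 1 - MvPolynomial.X 0]

/-- Auxiliary step `aeval_duP3`. [bookkeeping] -/
theorem aeval_duP3 (p : MvPolynomial (Fin 3) ℚ) (t : Fin 3 → ℝ) :
    MvPolynomial.aeval t (duP3 p) = MvPolynomial.aeval (duΦ t) p := by
  have e : (fun i => MvPolynomial.aeval t
      ((![MvPolynomial.C 1 - MvPolynomial.X 2, MvPolynomial.C 1 - MvPolynomial.X 1, MvPolynomial.C 1 - MvPolynomial.X 0] :
        Fin 3 → MvPolynomial (Fin 3) ℚ) i)) = duΦ t := by
    funext i
    fin_cases i <;> simp [duΦ_zero, duΦ_one, duΦ_two]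
  rw [duP3, MvPolynomial.aeval_bind₁, e]

/-- Auxiliary step `exists_aeval_ne_zero`. [bookkeeping] -/
private theorem exists_aeval_ne_zero {n : ℕ} {A : Set (Fin n → ℝ)} (hA : IsOpen A) (hne : A.Nonempty)
    {R : MvPolynomial (Fin n) ℚ} (hR : R ≠ 0) : ∃ x ∈ A, MvPolynomial.aeval x R ≠ 0 := by
  by_contra hcon
  push Not at hcon
  obtain ⟨x₀, hx₀⟩ := hne
  obtain ⟨δ, hδ, hball⟩ := Metric.isOpen_iff.1 hA x₀ hx₀
  apply hR
  have hmap : MvPolynomial.map (algebraMap ℚ ℝ) R = 0 := by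
    refine MvPolynomial.funext_set (fun i => Ioo (x₀ i - δ) (x₀ i + δ))
      (fun i => Set.Ioo_infinite (by linarith)) fun x hx => ?_
    rw [map_zero]
    have hxA : x ∈ A := by
      refine hball ?_
      rw [Metric.mem_ball, dist_pi_lt_iff hδ]
      intro i
      have hi := hx i (mem_univ i)
      rw [Real.dist_eq, abs_sub_lt_iff]
      constructor <;> linarith [hi.1, hi.2]
    rw [MvPolynomial.eval_map, ← MvPolynomial.aeval_def]
    exact hcon x hxA
  exact MvPolynomial.map_injective (algebraMap ℚ ℝ) (algebraMap ℚ ℝ).injective (by rw [hmap, map_zero])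

end GapFormPrereqs

section GapForm

/-! ## 24  THE GAP FORM OF A REDUCED NUMERATOR (gen 11, second addendum)

The simplex `Δ₃ = {1 > t₀ > t₁ > t₂ > 0}` is the standard 3-simplex in the four GAPS `g = (g₀,g₁,g₂,g₃) = (1-t₀, t₀-t₁, t₁-t₂, t₂)`
(positive, sum 1).  The five pole factors of a reduced datum are sums of CONSECUTIVE gaps: `t₀ = g₁+g₂+g₃`, `t₁ = g₂+g₃`,
`t₀-t₂ = g₁+g₂`, `1-t₁ = g₀+g₁`, `1-t₂ = g₀+g₁+g₂`, and the five strata of §23 are gap-coordinate strata: V0 = {g₁=g₂=g₃=0},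
E1 = {g₂=g₃=0}, Ed = {g₁=g₂=0}, E2 = {g₀=g₁=0}, V1 = {g₀=g₁=g₂=0}.  Vanishing orders along coordinate strata are read off
MONOMIAL-WISE — but only in a basis adapted to the stratum, and no basis of `ℚ[t₀,t₁,t₂]` is adapted to all five (e.g. `(t₀-t₂)²` vanishes
to order 2 along Ed while its monomials `t₀², t₀t₂, t₂²` do not).  The cure: HOMOGENISE the numerator in the four gaps.  Every `P` of degree
`≤ N` is, on the hyperplane `Σ g = 1`, a unique form `H(g)` of degree `N`; uniqueness lets us compute `H` from three different expansions of `P`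
(around V0, around V0 after `τ₀₁`, around V1 after `σ₃`), each of which exhibits some of the five order conditions monomial-wise.  Result
(`gap_form`): the five conditions of §23 hold for EVERY MONOMIAL `g^κ` of `H` —
`β₀+β₁+α ≤ κ₁+κ₂+κ₃+2`, `β₁ ≤ κ₂+κ₃+1`, `α ≤ κ₁+κ₂+1`, `γ₁ ≤ κ₀+κ₁+1`, `γ₂+γ₁+α ≤ κ₀+κ₁+κ₂+2` — so the reduced datum is a `ℚ`-combination of
GAP CLASSES `g^κ/((g₁+g₂+g₃)^β₀ (g₂+g₃)^β₁ (g₀+g₁)^γ₁ (g₀+g₁+g₂)^γ₂ (g₁+g₂)^α)` each satisfying the sector inequalities on its own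
(the starting point of MATCH: each gap class is separately convergent and is treated by integration by parts along root directions `g_i - g_j`). -/

/-! ### 24a  gaps and gap substitutions -/

/-- the four gaps `(1-t₀, t₀-t₁, t₁-t₂, t₂)`; they sum to `1` identically -/
def gaps (t : Fin 3 → ℝ) : Fin 4 → ℝ := ![1 - t 0, t 0 - t 1, t 1 - t 2, t 2]

/-- Auxiliary step `gaps_zero`. [bookkeeping] -/
@[simp] theorem gaps_zero (t : Fin 3 → ℝ) : gaps t 0 = 1 - t 0 := rfl
/-- Auxiliary step `gaps_one`. [bookkeeping] -/
@[simp] theorem gaps_one (t : Fin 3 → ℝ) : gaps t 1 = t 0 - t 1 := rfl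
/-- Auxiliary step `gaps_two`. [bookkeeping] -/
@[simp] theorem gaps_two (t : Fin 3 → ℝ) : gaps t 2 = t 1 - t 2 := rfl
/-- Auxiliary step `gaps_three`. [bookkeeping] -/
@[simp] theorem gaps_three (t : Fin 3 → ℝ) : gaps t 3 = t 2 := rfl

/-- Auxiliary step `sum_gaps`. [bookkeeping] -/
theorem sum_gaps (t : Fin 3 → ℝ) : ∑ i, gaps t i = 1 := by
  simp [Fin.sum_univ_four]

/-- `g₀+g₁+g₂+g₃` -/
def gsum : MvPolynomial (Fin 4) ℚ := MvPolynomial.X 0 + MvPolynomial.X 1 + MvPolynomial.X 2 + MvPolynomial.X 3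

/-- Auxiliary step `aeval_gaps_gsum`. [bookkeeping] -/
theorem aeval_gaps_gsum (t : Fin 3 → ℝ) : MvPolynomial.aeval (gaps t) gsum = 1 := by
  simp [gsum]

/-- Auxiliary step `isHomogeneous_gsum`. [bookkeeping] -/
theorem isHomogeneous_gsum : gsum.IsHomogeneous 1 :=
  (((MvPolynomial.isHomogeneous_X ℚ 0).add (MvPolynomial.isHomogeneous_X ℚ 1)).add
    (MvPolynomial.isHomogeneous_X ℚ 2)).add (MvPolynomial.isHomogeneous_X ℚ 3)

/-- `t` seen from V0: `t₀ = g₁+g₂+g₃, t₁ = g₂+g₃, t₂ = g₃` -/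
def gsub0 : Fin 3 → MvPolynomial (Fin 4) ℚ :=
  ![MvPolynomial.X 1 + MvPolynomial.X 2 + MvPolynomial.X 3, MvPolynomial.X 2 + MvPolynomial.X 3, MvPolynomial.X 3]
/-- `τ₀₁ t = (t₀, t₀-t₂, t₀-t₁)` in gaps: `(g₁+g₂+g₃, g₁+g₂, g₁)` -/
def gsubτ : Fin 3 → MvPolynomial (Fin 4) ℚ :=
  ![MvPolynomial.X 1 + MvPolynomial.X 2 + MvPolynomial.X 3, MvPolynomial.X 1 + MvPolynomial.X 2, MvPolynomial.X 1]
/-- `σ₃ t = (1-t₂, 1-t₁, 1-t₀)` in gaps: `(g₀+g₁+g₂, g₀+g₁, g₀)` -/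
def gsubσ : Fin 3 → MvPolynomial (Fin 4) ℚ :=
  ![MvPolynomial.X 0 + MvPolynomial.X 1 + MvPolynomial.X 2, MvPolynomial.X 0 + MvPolynomial.X 1, MvPolynomial.X 0]

/-- Auxiliary step `aeval_gaps_gsub0`. [bookkeeping] -/
theorem aeval_gaps_gsub0 (t : Fin 3 → ℝ) : (fun i => MvPolynomial.aeval (gaps t) (gsub0 i)) = t := by
  funext i
  fin_cases i <;> simp [gsub0]
/-- Auxiliary step `aeval_gaps_gsubτ`. [bookkeeping] -/
theorem aeval_gaps_gsubτ (t : Fin 3 → ℝ) : (fun i => MvPolynomial.aeval (gaps t) (gsubτ i)) = s01 t := by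
  funext i
  fin_cases i <;> simp [gsubτ, s01_zero, s01_one, s01_two]
/-- Auxiliary step `aeval_gaps_gsubσ`. [bookkeeping] -/
theorem aeval_gaps_gsubσ (t : Fin 3 → ℝ) : (fun i => MvPolynomial.aeval (gaps t) (gsubσ i)) = duΦ t := by
  funext i
  fin_cases i <;> simp [gsubσ, duΦ_zero, duΦ_one, duΦ_two]

/-- Auxiliary step `isHomogeneous_gsub0`. [bookkeeping] -/
theorem isHomogeneous_gsub0 (i : Fin 3) : (gsub0 i).IsHomogeneous 1 := by
  fin_cases i
  · exact ((MvPolynomial.isHomogeneous_X ℚ 1).add (MvPolynomial.isHomogeneous_X ℚ 2)).add (MvPolynomial.isHomogeneous_X ℚ 3)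
  · exact (MvPolynomial.isHomogeneous_X ℚ 2).add (MvPolynomial.isHomogeneous_X ℚ 3)
  · exact MvPolynomial.isHomogeneous_X ℚ 3
/-- Auxiliary step `isHomogeneous_gsubτ`. [bookkeeping] -/
theorem isHomogeneous_gsubτ (i : Fin 3) : (gsubτ i).IsHomogeneous 1 := by
  fin_cases i
  · exact ((MvPolynomial.isHomogeneous_X ℚ 1).add (MvPolynomial.isHomogeneous_X ℚ 2)).add (MvPolynomial.isHomogeneous_X ℚ 3)
  · exact (MvPolynomial.isHomogeneous_X ℚ 1).add (MvPolynomial.isHomogeneous_X ℚ 2)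
  · exact MvPolynomial.isHomogeneous_X ℚ 1
/-- Auxiliary step `isHomogeneous_gsubσ`. [bookkeeping] -/
theorem isHomogeneous_gsubσ (i : Fin 3) : (gsubσ i).IsHomogeneous 1 := by
  fin_cases i
  · exact ((MvPolynomial.isHomogeneous_X ℚ 0).add (MvPolynomial.isHomogeneous_X ℚ 1)).add (MvPolynomial.isHomogeneous_X ℚ 2)
  · exact (MvPolynomial.isHomogeneous_X ℚ 0).add (MvPolynomial.isHomogeneous_X ℚ 1)
  · exact MvPolynomial.isHomogeneous_X ℚ 0

/-! ### 24b  homogenisation along a linear substitution -/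

/-- `hom_N^f(Q) = Σ_d f(Q_d)·(Σg)^{N-d}`, `Q_d` the homogeneous components of `Q` -/
def homF (f : Fin 3 → MvPolynomial (Fin 4) ℚ) (N : ℕ) (Q : MvPolynomial (Fin 3) ℚ) : MvPolynomial (Fin 4) ℚ :=
  ∑ d ∈ Finset.range (N + 1), MvPolynomial.bind₁ f (MvPolynomial.homogeneousComponent d Q) * gsum ^ (N - d)

/-- Auxiliary step `isHomogeneous_homF`. [bookkeeping] -/
theorem isHomogeneous_homF {f : Fin 3 → MvPolynomial (Fin 4) ℚ} (hf : ∀ i, (f i).IsHomogeneous 1) (N : ℕ)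
    (Q : MvPolynomial (Fin 3) ℚ) : (homF f N Q).IsHomogeneous N := by
  refine MvPolynomial.IsHomogeneous.sum _ _ _ fun d hd => ?_
  have hd' : d ≤ N := by simpa [Nat.lt_succ_iff] using hd
  have h1 : (MvPolynomial.aeval f (MvPolynomial.homogeneousComponent d Q)).IsHomogeneous d := by
    simpa using (MvPolynomial.homogeneousComponent_isHomogeneous d Q).aeval f hf
  have h2 : (gsum ^ (N - d)).IsHomogeneous (N - d) := by
    simpa using isHomogeneous_gsum.pow (N - d)
  have := h1.mul h2
  rw [Nat.add_sub_cancel' hd'] at this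
  exact this

/-- Auxiliary step `sum_homogeneousComponent_of_le`. [bookkeeping] -/
theorem sum_homogeneousComponent_of_le (Q : MvPolynomial (Fin 3) ℚ) {N : ℕ} (hN : Q.totalDegree ≤ N) :
    ∑ d ∈ Finset.range (N + 1), MvPolynomial.homogeneousComponent d Q = Q := by
  rw [← Finset.sum_subset (Finset.range_subset_range.2 (by omega : Q.totalDegree + 1 ≤ N + 1))
    (fun d _ hd => MvPolynomial.homogeneousComponent_eq_zero _ _
      (by simp only [Finset.mem_range, not_lt] at hd; omega))]
  exact MvPolynomial.sum_homogeneousComponent Q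

/-- Auxiliary step `aeval_gaps_homF`. [bookkeeping] -/
theorem aeval_gaps_homF (f : Fin 3 → MvPolynomial (Fin 4) ℚ) {N : ℕ} {Q : MvPolynomial (Fin 3) ℚ}
    (hN : Q.totalDegree ≤ N) (t : Fin 3 → ℝ) :
    MvPolynomial.aeval (gaps t) (homF f N Q) = MvPolynomial.aeval (fun i => MvPolynomial.aeval (gaps t) (f i)) Q := by
  simp only [homF, map_sum, map_mul, map_pow, aeval_gaps_gsum, one_pow, mul_one, MvPolynomial.aeval_bind₁]
  rw [← map_sum, sum_homogeneousComponent_of_le Q hN]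

/-! ### 24c  monomial-wise lower bounds of weighted order: the `GLow` calculus -/

/-- every monomial of `H` has `w`-weight `≥ m` -/
def GLow {n : ℕ} (w : Fin n → ℕ) (m : ℕ) (H : MvPolynomial (Fin n) ℚ) : Prop :=
  ∀ κ ∈ H.support, m ≤ ∑ i, w i * κ i

/-- Auxiliary step `mono`. [bookkeeping] -/
theorem GLow.mono {n : ℕ} {w : Fin n → ℕ} {m m' : ℕ} {H : MvPolynomial (Fin n) ℚ} (h : GLow w m H) (hm : m' ≤ m) :
    GLow w m' H := fun κ hκ => hm.trans (h κ hκ)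

/-- Auxiliary step `glow_zero`. [bookkeeping] -/
theorem glow_zero {n : ℕ} (w : Fin n → ℕ) (H : MvPolynomial (Fin n) ℚ) : GLow w 0 H := fun _ _ => Nat.zero_le _

/-- Auxiliary step `add`. [bookkeeping] -/
theorem GLow.add {n : ℕ} {w : Fin n → ℕ} {m : ℕ} {H₁ H₂ : MvPolynomial (Fin n) ℚ} (h₁ : GLow w m H₁) (h₂ : GLow w m H₂) :
    GLow w m (H₁ + H₂) := by
  intro κ hκ
  rcases Finset.mem_union.1 (MvPolynomial.support_add hκ) with h | h
  · exact h₁ κ h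
  · exact h₂ κ h

/-- Auxiliary step `glow_of_zero`. [bookkeeping] -/
theorem glow_of_zero {n : ℕ} (w : Fin n → ℕ) (m : ℕ) : GLow w m (0 : MvPolynomial (Fin n) ℚ) := fun κ hκ => by
  simp at hκ

/-- Auxiliary step `sum`. [bookkeeping] -/
theorem GLow.sum {n : ℕ} {w : Fin n → ℕ} {m : ℕ} {ι : Type*} (s : Finset ι) {F : ι → MvPolynomial (Fin n) ℚ}
    (h : ∀ i ∈ s, GLow w m (F i)) : GLow w m (∑ i ∈ s, F i) :=
  Finset.sum_induction F (GLow w m) (fun _ _ ha hb => ha.add hb) (glow_of_zero w m) h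

/-- Auxiliary step `mul`. [bookkeeping] -/
theorem GLow.mul {n : ℕ} {w : Fin n → ℕ} {m₁ m₂ : ℕ} {H₁ H₂ : MvPolynomial (Fin n) ℚ} (h₁ : GLow w m₁ H₁) (h₂ : GLow w m₂ H₂) :
    GLow w (m₁ + m₂) (H₁ * H₂) := by
  classical
  intro κ hκ
  obtain ⟨a, ha, b, hb, rfl⟩ := Finset.mem_add.1 (MvPolynomial.support_mul H₁ H₂ hκ)
  have e : ∑ i, w i * (a + b) i = ∑ i, w i * a i + ∑ i, w i * b i := by
    rw [← Finset.sum_add_distrib]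
    exact Finset.sum_congr rfl fun i _ => by rw [Finsupp.add_apply, mul_add]
  rw [e]
  exact add_le_add (h₁ a ha) (h₂ b hb)

/-- Auxiliary step `pow`. [bookkeeping] -/
theorem GLow.pow {n : ℕ} {w : Fin n → ℕ} {m : ℕ} {H : MvPolynomial (Fin n) ℚ} (h : GLow w m H) (k : ℕ) :
    GLow w (m * k) (H ^ k) := by
  induction k with
  | zero =>
    rw [pow_zero, Nat.mul_zero]
    exact glow_zero w 1
  | succ k ih =>
    rw [pow_succ, Nat.mul_succ]
    exact ih.mul h

/-- Auxiliary step `glow_X`. [bookkeeping] -/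
theorem glow_X {n : ℕ} (w : Fin n → ℕ) {m : ℕ} (i : Fin n) (hm : m ≤ w i) :
    GLow w m (MvPolynomial.X i : MvPolynomial (Fin n) ℚ) := by
  intro κ hκ
  rw [MvPolynomial.support_X, Finset.mem_singleton] at hκ
  subst hκ
  refine hm.trans (le_of_eq ?_)
  rw [Finset.sum_eq_single i (fun j _ hj => by simp [Finsupp.single_eq_of_ne hj]) (by simp)]
  simp

/-- transfer through a substitution: if the variables go to polynomials of `w`-orders `≥ a i`, a polynomial whose monomials have
`a`-weight `≥ m` goes to one whose monomials have `w`-weight `≥ m` -/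
theorem GLow.bind₁ {w : Fin 4 → ℕ} {f : Fin 3 → MvPolynomial (Fin 4) ℚ} {a : Fin 3 → ℕ} (hf : ∀ i, GLow w (a i) (f i))
    {Q : MvPolynomial (Fin 3) ℚ} {m : ℕ} (hQ : ∀ e ∈ Q.support, m ≤ ∑ i, a i * e i) :
    GLow w m (MvPolynomial.bind₁ f Q) := by
  rw [MvPolynomial.as_sum Q, map_sum]
  refine GLow.sum _ fun e he => ?_
  rw [MvPolynomial.bind₁_monomial, Finset.prod_subset (Finset.subset_univ e.support)
    (fun i _ hi => by rw [Finsupp.notMem_support_iff.1 hi, pow_zero])]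
  have hprod : GLow w (a 0 * e 0 + a 1 * e 1 + a 2 * e 2) (∏ i, f i ^ e i) := by
    rw [Fin.prod_univ_three]
    exact (((hf 0).pow (e 0)).mul ((hf 1).pow (e 1))).mul ((hf 2).pow (e 2))
  have := (glow_zero w (MvPolynomial.C (MvPolynomial.coeff e Q) : MvPolynomial (Fin 4) ℚ)).mul hprod
  rw [zero_add] at this
  refine this.mono ?_
  simpa [Fin.sum_univ_three] using hQ e he

/-- Auxiliary step `homF`. [bookkeeping] -/
theorem GLow.homF {w : Fin 4 → ℕ} {f : Fin 3 → MvPolynomial (Fin 4) ℚ} {a : Fin 3 → ℕ} (hf : ∀ i, GLow w (a i) (f i))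
    {Q : MvPolynomial (Fin 3) ℚ} {m : ℕ} (hQ : ∀ e ∈ Q.support, m ≤ ∑ i, a i * e i) (N : ℕ) :
    GLow w m (homF f N Q) := by
  refine GLow.sum _ fun d _ => ?_
  have h1 : GLow w m (MvPolynomial.bind₁ f (MvPolynomial.homogeneousComponent d Q)) :=
    GLow.bind₁ hf fun e he => hQ e (by
      rw [MvPolynomial.support_homogeneousComponent, Finset.mem_filter] at he
      exact he.1)
  simpa using h1.mul (glow_zero w (gsum ^ (N - d)))

/-! ### 24d  uniqueness of the gap form -/

/-- Auxiliary step `aeval_smul_of_isHomogeneous`. [bookkeeping] -/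
theorem aeval_smul_of_isHomogeneous {G : MvPolynomial (Fin 4) ℚ} {N : ℕ} (hG : G.IsHomogeneous N) (c : ℝ)
    (x : Fin 4 → ℝ) : MvPolynomial.aeval (c • x) G = c ^ N * MvPolynomial.aeval x G := by
  rw [MvPolynomial.aeval_def, MvPolynomial.eval₂_eq', MvPolynomial.aeval_def, MvPolynomial.eval₂_eq', Finset.mul_sum]
  refine Finset.sum_congr rfl fun d hd => ?_
  have hdeg : ∑ i, d i = N := by
    have h := hG (MvPolynomial.mem_support_iff.1 hd)
    rw [← Finsupp.degree_eq_sum]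
    rw [Finsupp.degree_eq_weight_one]
    exact h
  simp only [Pi.smul_apply, smul_eq_mul, mul_pow, Finset.prod_mul_distrib, Finset.prod_pow_eq_pow_sum, hdeg]
  ring

/-- two forms of the same degree that agree on the gaps of every point are equal (scaling + §22b) -/
theorem eq_of_aeval_gaps_eq {H H' : MvPolynomial (Fin 4) ℚ} {N : ℕ} (hH : H.IsHomogeneous N) (hH' : H'.IsHomogeneous N)
    (h : ∀ t : Fin 3 → ℝ, MvPolynomial.aeval (gaps t) H = MvPolynomial.aeval (gaps t) H') : H = H' := by
  by_contra hne
  have hG : H - H' ≠ 0 := sub_ne_zero.2 hne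
  have hA : IsOpen {g : Fin 4 → ℝ | ∑ i, g i ≠ 0} := isOpen_ne_fun (by fun_prop) continuous_const
  have hAne : ({g : Fin 4 → ℝ | ∑ i, g i ≠ 0} : Set (Fin 4 → ℝ)).Nonempty :=
    ⟨fun _ => 1, by simp [Fin.sum_univ_four]; norm_num⟩
  obtain ⟨g, hg, hgG⟩ := exists_aeval_ne_zero hA hAne hG
  apply hgG
  have hc : (∑ i, g i) ≠ 0 := hg
  set c : ℝ := ∑ i, g i with hc_def
  let t : Fin 3 → ℝ := ![1 - g 0 / c, (g 2 + g 3) / c, g 3 / c]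
  have hc4 : c = g 0 + g 1 + g 2 + g 3 := by simp [hc_def, Fin.sum_univ_four, add_assoc]
  have hgap : gaps t = c⁻¹ • g := by
    funext i
    fin_cases i
    · simp [t]; field_simp
    · simp [t]; field_simp; rw [hc4]; ring
    · simp [t]; field_simp; ring
    · simp [t]; field_simp
  have hg' : g = c • gaps t := by rw [hgap, smul_smul, mul_inv_cancel₀ hc, one_smul]
  rw [hg', map_sub, aeval_smul_of_isHomogeneous hH, aeval_smul_of_isHomogeneous hH', h t, sub_self]

/-! ### 24e  the gap form with monomial-wise orders -/

end GapForm
end Summit.KontsevichZagierPeriods.RootDecompZetaThreeFrontier.WordLayer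
end
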